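import Literature.AnabelianGeometry.EtaleTheta.Discharge.Sec3PhiZeroCountablePrimesConnected
import Literature.AnabelianGeometry.EtaleTheta.Discharge.Sec3Cor38iiiOfRlfWeak
import Literature.AnabelianGeometry.EtaleTheta.Discharge.Sec3Thm37ivGenuineBase
import Literature.AnabelianGeometry.EtaleTheta.BiKummerThm44SubModelConnectedOfGaloisCovering
import Literature.AnabelianGeometry.EtaleTheta.RealificationPfImageWeak
import Literature.AnabelianGeometry.EtaleTheta.Discharge.Sec3Cor38iiiOfRlfRWeak
import Literature.AnabelianGeometry.EtaleTheta.Discharge.Sec3BLambdaInjectiveOfGaloisCoveringConnected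
import Literature.AnabelianGeometry.EtaleTheta.Discharge.Sec3Cor38iiiOfRlfQWeak
import HarnessLib

/-!
# [EtTh] Cor. 3.8 (iii), first clause, over the weak realified Def. 3.3 (iii) data of the CONNECTED coverings
# (`ofRlfZWeak (ofGaloisActionConnected A hZ) hpf`): the `hcnt` binders CLOSED by name — consumer knit

S. Mochizuki, *The étale theta function and its Frobenioid-theoretic manifestations*, Publ. RIMS **45** (2009)
[MochizukiEtTh2009], §3: Cor. 3.8 (iii) PDF p.81 (proof p.82: "by considering the factorization homomorphisms"),
Def. 3.3 (iii) p.73, Rmk. 3.3.1 p.73, Def. 3.6 (ii) p.77, Ex. 3.9 (iii) p.84 ("`Φ_W` … given by forming the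
perfection of the monoid `Φ₀`" — print's choice `Φ := ι(Φ₀^pf)` of the divisor monoid of a tempered Frobenioid)
[cite: MochizukiEtTh2009, Cor 3.8 p.81]; S. Mochizuki, *The geometry of Frobenioids I* (2008) [MochizukiFrdI2008],
Thm. 5.2 (ii) p.100.

abc-iut cell, layer L2, PROOF-ONLY file (theorems only), seat abc-iut-w6-d052 (gen 6), row R283 of abc-iut-L2-lead
«hcnt CONSUMER KNIT @ofGaloisActionConnected».  abc-iut-L2-d2's weak Cor. 3.8 (iii) apex
`cor38_iii_ofRlfZWeak_of_isFrobenioid_of_countable_of_prop34Const` (`Sec3Cor38iiiOfRlfWeak.lean`) has three residual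
inputs per side: `IsFrobenioid`, `hcnt : ∀ A, Countable (Primes (Perfection ↥(C.Φ.carrier A)))` (GAP-LEDGER
G-L2d2-4), `Prop34Const` (G-L2d2-3).  THIS FILE closes `hcnt` BY NAME at the constructed data of the connected
coverings (abc-iut-w6-d058's `DivisorMonoids.ofGaloisActionConnected`, p437704):

* `TemperedFrobenioid.countable_primes_perfection_Φ_of_eq_mrange` — over ANY `ofRlfZWeak dm hpf`: if the divisor
  monoid is print's `Φ(A) = ι(Φ₀(Y_A)^pf) ⊆ Φ₀(Y_A)^rlf` (`MonoidHom.mrange toRealification`; abc-iut-L2-d2's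
  `PfImageWeak.mrangeRestrict_toRealification_bijective`, p-landed) then `hcnt` at `A` follows from
  `Countable (Primes (Perfection ↥(dm.Φ₀.obj (C.baseOp A))))`;
* `cor38_iii_ofRlfZWeak_of_isFrobenioid_of_eq_mrange_of_prop34Const` — the apex with `hcnt_i` replaced by the
  `Φ₀`-level countability + the `Φ`-tie;
* **`cor38_iii_ofGaloisActionConnected_of_isFrobenioid_of_eq_mrange`** — at `dm_i := ofGaloisActionConnected A_i hZ_i`
  the `Φ₀`-level countability is a THEOREM (`DivisorMonoids.countable_primes_perfection_Φ₀_ofGaloisActionConnected`,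
  p441898, from abc-iut-w5-d153's p440853) under the instance binders `[Countable G_i] [Countable Z_i.Cusp]
  [Countable Z_i.Comp]` (print: `Gal(Z^log_∞/X^log)` countable — `Z → X` finite Galois composed with the universal
  combinatorial covering, Def. 3.3 (ii); finitely many cusps; components of the special fibre);
* **`cor38_iii_ofGaloisActionConnected_of_isOfFSMType_of_eq_mrange`** / **`…_connectedPart_bTemp_of_eq_mrange`** —
  moreover `IsFrobenioid_i` DISCHARGED (the terms of abc-iut-w5-d179's
  `isFrobenioid_ofRlfZWeak_ofGaloisActionConnected_{of_isOfFSMType, connectedPart_bTemp}`,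
  `Sec3OfGaloisCoveringConnectedRealified.lean`: `TemperedFrobenioid.isFrobenioid_{of_isOfFSMType, connectedPart_bTemp}`
  ∘ `DivisorMonoids.ofGaloisActionConnected_ofRlfZWeak_hBinj`, p439044) over the genuine category vocabulary
  `treeCatVocab`: at the genuine
  base `B^temp(Π)⁰` the ONLY remaining named inputs of [EtTh] Cor. 3.8 (iii), first clause, are the Cor. 3.8 datum
  `h`, the `Φ`-tie `hΦ_i` (print's choice of `Φ`) and `Prop34Const` (G-L2d2-3).

HONEST LIMIT: without a tie between `Φ(A)` and `Φ₀(Y_A)` the binder `hcnt` is NOT derivable at an abstract tempered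
Frobenioid (GAP row G-L2d2-4: Def. 3.6 (ii) as typed allows group-saturated perf-factorial sub-data of `Φ₀^rlf` with
uncountably many primes); the tie used here is print's `Φ := ι(Φ₀^pf)` (Ex. 3.9 (iii)); Ex. 3.9's further
`ell`-saturated sub-choices are again invariant sub-monoids and would be handled by the same fixed-point engine, not by
this file.  HONEST FRAMING: classical bookkeeping over typed interfaces; `LogDivisorModel` / `GaloisAction` are
parameter records (nothing asserts they arise from a curve); nothing here bears on [IUTchIII] Cor. 3.12; typed ≠
proved — here proved.
-/

namespace Literature.AnabelianGeometry.EtaleTheta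

open CategoryTheory Opposite Literature.AlgebraicGeometry.Frobenioids Literature.AnabelianGeometry.SemiGraphs

universe u₀ v₀ u v w u' v'

/-! ### `hcnt` from the `Φ`-tie `Φ(A) = ι(Φ₀(Y_A)^pf)` over any weak realified data -/

namespace TemperedFrobenioid

variable {D₀ : Type u₀} [Category.{v₀} D₀] {dm : DivisorMonoids.{u₀, v₀, w} D₀}
  {hpf : ∀ Y : D₀ᵒᵖ, IsPerfFactorialCof (dm.Φ₀.obj Y)}
  {D : Type u} [Category.{v} D] {VD : FrdICatStub.{u, v, w} D}
  (C : TemperedFrobenioid (RealifiedDivisorMonoids.ofRlfZWeak dm hpf) D VD)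

/-- **`hcnt` at `A` from the `Φ`-tie**: if `Φ(A)` is print's `ι(Φ₀(Y_A)^pf) ⊆ Φ₀(Y_A)^rlf` (Ex. 3.9 (iii): "`Φ_W` …
forming the perfection of the monoid `Φ₀`"), then `Prime(Φ(A)^pf)` is countable as soon as `Prime(Φ₀(Y_A)^pf)` is —
`ι` is injective on `Φ₀^pf` (`PfImageWeak.mrangeRestrict_toRealification_bijective`) and `Prime(M) ≃ Prime(M^pf)` for
the sharp monoid `M = ι(Φ₀^pf)`. [cite: MochizukiEtTh2009, Ex 3.9 p.84] -/
theorem countable_primes_perfection_Φ_of_eq_mrange (A : Dᵒᵖ)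
    (hΦ : C.Φ.carrier A = MonoidHom.mrange (hpf (C.baseOp A)).weak.toRealification)
    [Countable (Primes (Perfection ↥(dm.Φ₀.obj (C.baseOp A))))] :
    Countable (Primes (Perfection ↥(C.Φ.carrier A))) := by
  have hM := hpf (C.baseOp A)
  haveI : Countable (Primes ↥(MonoidHom.mrange hM.weak.toRealification)) :=
    countable_primes_of_mulEquiv
      (MulEquiv.ofBijective _ (PfImageWeak.mrangeRestrict_toRealification_bijective hM.weak))
  have h := (PfImageWeak.isPerfFactorialCof_mrange_toRealification hM).weak.countable_primes_perfection
  rw [hΦ]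
  exact h

end TemperedFrobenioid

/-! ### The weak Cor. 3.8 (iii) apex with `hcnt` traded for the `Φ₀`-level countability -/

section General

variable {D₀ : Type u₀} [Category.{v₀} D₀] {dm : DivisorMonoids.{u₀, v₀, w} D₀}
  {hpf : ∀ Y : D₀ᵒᵖ, IsPerfFactorialCof (dm.Φ₀.obj Y)}
  {D : Type u} [Category.{v} D] {VD : FrdICatStub.{u, v, w} D}
  {D₀' : Type u₀} [Category.{v₀} D₀'] {dm' : DivisorMonoids.{u₀, v₀, w} D₀'}
  {hpf' : ∀ Y : D₀'ᵒᵖ, IsPerfFactorialCof (dm'.Φ₀.obj Y)}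
  {D' : Type u} [Category.{v} D'] {VD' : FrdICatStub.{u, v, w} D'}
  {C₁ : TemperedFrobenioid (RealifiedDivisorMonoids.ofRlfZWeak dm hpf) D VD}
  {C₂ : TemperedFrobenioid (RealifiedDivisorMonoids.ofRlfZWeak dm' hpf') D' VD'} (h : Cor38Hyp C₁ C₂)

/-- **[EtTh] Cor. 3.8 (iii), first clause, over `ofRlfZWeak`, with `hcnt_i` replaced by countability of
`Prime(Φ₀(Y_A)^pf)` and the `Φ`-tie `Φ_i(A) = ι(Φ₀(Y_A)^pf)`** (abc-iut-L2-d2's apex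
`cor38_iii_ofRlfZWeak_of_isFrobenioid_of_countable_of_prop34Const` ∘ `countable_primes_perfection_Φ_of_eq_mrange`).
Remaining named inputs: `IsFrobenioid_i`, `Prop34Const_i`, the `Φ`-ties, the `Φ₀`-level countabilities.
[cite: MochizukiEtTh2009, Cor 3.8 p.81] -/
theorem cor38_iii_ofRlfZWeak_of_isFrobenioid_of_eq_mrange_of_prop34Const
    (hΦ₁ : ∀ A : Dᵒᵖ, C₁.Φ.carrier A = MonoidHom.mrange (hpf (C₁.baseOp A)).weak.toRealification)
    (hΦ₂ : ∀ A : D'ᵒᵖ, C₂.Φ.carrier A = MonoidHom.mrange (hpf' (C₂.baseOp A)).weak.toRealification)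
    (hcnt₁ : ∀ A : Dᵒᵖ, Countable (Primes (Perfection ↥(dm.Φ₀.obj (C₁.baseOp A)))))
    (hcnt₂ : ∀ A : D'ᵒᵖ, Countable (Primes (Perfection ↥(dm'.Φ₀.obj (C₂.baseOp A)))))
    (hC₁ : dm.Prop34Const) (hC₂ : dm'.Prop34Const)
    (hF₁ : PreFrobenioid.IsFrobenioid C₁.toElem) (hF₂ : PreFrobenioid.IsFrobenioid C₂.toElem) :
    Cor38_iii h :=
  cor38_iii_ofRlfZWeak_of_isFrobenioid_of_countable_of_prop34Const h
    (fun A => haveI := hcnt₁ A; C₁.countable_primes_perfection_Φ_of_eq_mrange A (hΦ₁ A))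
    (fun A => haveI := hcnt₂ A; C₂.countable_primes_perfection_Φ_of_eq_mrange A (hΦ₂ A))
    hC₁ hC₂ hF₁ hF₂

end General

/-! ### At the constructed data of the connected coverings: `hcnt` is a theorem -/

section Connected

open LogDivisorModel.GaloisAction

variable {Z : LogDivisorModel.{u}} {G : Type u} [Group G] {A : Z.GaloisAction G} {hZ : Z.CuspLaws}
  {hpf : ∀ Y : ((isConnectedGSet (G := G)).FullSubcategory)ᵒᵖ,
    IsPerfFactorialCof ((DivisorMonoids.ofGaloisActionConnected A hZ).Φ₀.obj Y)}
  {Z' : LogDivisorModel.{u}} {G' : Type u} [Group G'] {A' : Z'.GaloisAction G'} {hZ' : Z'.CuspLaws}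
  {hpf' : ∀ Y : ((isConnectedGSet (G := G')).FullSubcategory)ᵒᵖ,
    IsPerfFactorialCof ((DivisorMonoids.ofGaloisActionConnected A' hZ').Φ₀.obj Y)}
  {D : Type u'} [Category.{v'} D] {VD : FrdICatStub.{u', v', u} D}
  {D' : Type u'} [Category.{v'} D'] {VD' : FrdICatStub.{u', v', u} D'}
  {C₁ : TemperedFrobenioid
    (RealifiedDivisorMonoids.ofRlfZWeak (DivisorMonoids.ofGaloisActionConnected A hZ) hpf) D VD}
  {C₂ : TemperedFrobenioid
    (RealifiedDivisorMonoids.ofRlfZWeak (DivisorMonoids.ofGaloisActionConnected A' hZ') hpf') D' VD'}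

/-- **[EtTh] Cor. 3.8 (iii), first clause, at the weak realified data of the CONNECTED coverings, `hcnt_i` CLOSED by
name** (`DivisorMonoids.countable_primes_perfection_Φ₀_ofGaloisActionConnected`, p441898 ∘ p440853): for tempered
Frobenioids `C_i` over `ofRlfZWeak (ofGaloisActionConnected A_i hZ_i) hpf_i` with print's divisor monoids
`Φ_i(A) = ι(Φ₀(Y_A)^pf)` and countable `Gal(Z^log_∞/X^log)`, cusps and special-fibre components, the remaining named
inputs are `IsFrobenioid_i` and `Prop34Const_i` (G-L2d2-3). [cite: MochizukiEtTh2009, Cor 3.8 p.81] -/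
theorem cor38_iii_ofGaloisActionConnected_of_isFrobenioid_of_eq_mrange
    [Countable G] [Countable Z.Cusp] [Countable Z.Comp] [Countable G'] [Countable Z'.Cusp] [Countable Z'.Comp]
    (h : Cor38Hyp C₁ C₂)
    (hΦ₁ : ∀ B : Dᵒᵖ, C₁.Φ.carrier B = MonoidHom.mrange (hpf (C₁.baseOp B)).weak.toRealification)
    (hΦ₂ : ∀ B : D'ᵒᵖ, C₂.Φ.carrier B = MonoidHom.mrange (hpf' (C₂.baseOp B)).weak.toRealification)
    (hC₁ : (DivisorMonoids.ofGaloisActionConnected A hZ).Prop34Const)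
    (hC₂ : (DivisorMonoids.ofGaloisActionConnected A' hZ').Prop34Const)
    (hF₁ : PreFrobenioid.IsFrobenioid C₁.toElem) (hF₂ : PreFrobenioid.IsFrobenioid C₂.toElem) :
    Cor38_iii h :=
  cor38_iii_ofRlfZWeak_of_isFrobenioid_of_eq_mrange_of_prop34Const h hΦ₁ hΦ₂
    (fun B => DivisorMonoids.countable_primes_perfection_Φ₀_ofGaloisActionConnected A hZ (C₁.baseOp B))
    (fun B => DivisorMonoids.countable_primes_perfection_Φ₀_ofGaloisActionConnected A' hZ' (C₂.baseOp B))
    hC₁ hC₂ hF₁ hF₂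

end Connected

/-! ### … and `IsFrobenioid` discharged over the genuine category vocabulary -/

section ConnectedFSM

open LogDivisorModel.GaloisAction

variable {Z : LogDivisorModel.{u}} {G : Type u} [Group G] {A : Z.GaloisAction G} {hZ : Z.CuspLaws}
  {hpf : ∀ Y : ((isConnectedGSet (G := G)).FullSubcategory)ᵒᵖ,
    IsPerfFactorialCof ((DivisorMonoids.ofGaloisActionConnected A hZ).Φ₀.obj Y)}
  {Z' : LogDivisorModel.{u}} {G' : Type u} [Group G'] {A' : Z'.GaloisAction G'} {hZ' : Z'.CuspLaws}
  {hpf' : ∀ Y : ((isConnectedGSet (G := G')).FullSubcategory)ᵒᵖ,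
    IsPerfFactorialCof ((DivisorMonoids.ofGaloisActionConnected A' hZ').Φ₀.obj Y)}
  {D : Type u'} [Category.{v'} D] {IsRational IsStrictlyRational : (Dᵒᵖ ⥤ CommMonCat.{u}) → Prop}
  {D' : Type u'} [Category.{v'} D'] {IsRational' IsStrictlyRational' : (D'ᵒᵖ ⥤ CommMonCat.{u}) → Prop}
  {C₁ : TemperedFrobenioid
    (RealifiedDivisorMonoids.ofRlfZWeak (DivisorMonoids.ofGaloisActionConnected A hZ) hpf) D
    (treeCatVocab D IsRational IsStrictlyRational)}
  {C₂ : TemperedFrobenioid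
    (RealifiedDivisorMonoids.ofRlfZWeak (DivisorMonoids.ofGaloisActionConnected A' hZ') hpf') D'
    (treeCatVocab D' IsRational' IsStrictlyRational')}

/-- **[EtTh] Cor. 3.8 (iii), first clause, at the weak realified data of the connected coverings over ANY bases of
FSM-type in the genuine category vocabulary — `hcnt_i` AND `IsFrobenioid_i` CLOSED by name** («`C` is a Frobenioid»,
[FrdI] Thm. 5.2 (ii): `TemperedFrobenioid.isFrobenioid_of_isOfFSMType` with `hBinj :=
DivisorMonoids.ofGaloisActionConnected_ofRlfZWeak_hBinj`, p439044 — the term of abc-iut-w5-d179's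
`isFrobenioid_ofRlfZWeak_ofGaloisActionConnected_of_isOfFSMType`).  Remaining named inputs: the Cor. 3.8 datum `h`, the `Φ`-ties (print's `Φ := ι(Φ₀^pf)`),
`Prop34Const_i` (G-L2d2-3), `IsOfFSMType D_i` ([FrdII] Ex. 1.3 (i) at `B^temp(Π)⁰`). [cite: MochizukiEtTh2009, Cor 3.8 p.81] -/
theorem cor38_iii_ofGaloisActionConnected_of_isOfFSMType_of_eq_mrange
    [Countable G] [Countable Z.Cusp] [Countable Z.Comp] [Countable G'] [Countable Z'.Cusp] [Countable Z'.Comp]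
    (h : Cor38Hyp C₁ C₂) (hD : IsOfFSMType D) (hD' : IsOfFSMType D')
    (hΦ₁ : ∀ B : Dᵒᵖ, C₁.Φ.carrier B = MonoidHom.mrange (hpf (C₁.baseOp B)).weak.toRealification)
    (hΦ₂ : ∀ B : D'ᵒᵖ, C₂.Φ.carrier B = MonoidHom.mrange (hpf' (C₂.baseOp B)).weak.toRealification)
    (hC₁ : (DivisorMonoids.ofGaloisActionConnected A hZ).Prop34Const)
    (hC₂ : (DivisorMonoids.ofGaloisActionConnected A' hZ').Prop34Const) : Cor38_iii h :=
  cor38_iii_ofGaloisActionConnected_of_isFrobenioid_of_eq_mrange h hΦ₁ hΦ₂ hC₁ hC₂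
    (C₁.isFrobenioid_of_isOfFSMType (DivisorMonoids.ofGaloisActionConnected_ofRlfZWeak_hBinj A hZ hpf) hD)
    (C₂.isFrobenioid_of_isOfFSMType (DivisorMonoids.ofGaloisActionConnected_ofRlfZWeak_hBinj A' hZ' hpf') hD')

end ConnectedFSM

section ConnectedGenuineBase

open LogDivisorModel.GaloisAction

variable {Z : LogDivisorModel.{u}} {G : Type u} [Group G] {A : Z.GaloisAction G} {hZ : Z.CuspLaws}
  {hpf : ∀ Y : ((isConnectedGSet (G := G)).FullSubcategory)ᵒᵖ,
    IsPerfFactorialCof ((DivisorMonoids.ofGaloisActionConnected A hZ).Φ₀.obj Y)}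
  {Z' : LogDivisorModel.{u}} {G' : Type u} [Group G'] {A' : Z'.GaloisAction G'} {hZ' : Z'.CuspLaws}
  {hpf' : ∀ Y : ((isConnectedGSet (G := G')).FullSubcategory)ᵒᵖ,
    IsPerfFactorialCof ((DivisorMonoids.ofGaloisActionConnected A' hZ').Φ₀.obj Y)}
  {P : Type v'} [Group P] [TopologicalSpace P]
  {IsRational IsStrictlyRational : ((ConnectedPart (BTemp P))ᵒᵖ ⥤ CommMonCat.{u}) → Prop}
  {P' : Type v'} [Group P'] [TopologicalSpace P']
  {IsRational' IsStrictlyRational' : ((ConnectedPart (BTemp P'))ᵒᵖ ⥤ CommMonCat.{u}) → Prop}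
  {C₁ : TemperedFrobenioid
    (RealifiedDivisorMonoids.ofRlfZWeak (DivisorMonoids.ofGaloisActionConnected A hZ) hpf)
    (ConnectedPart (BTemp P)) (treeCatVocab (ConnectedPart (BTemp P)) IsRational IsStrictlyRational)}
  {C₂ : TemperedFrobenioid
    (RealifiedDivisorMonoids.ofRlfZWeak (DivisorMonoids.ofGaloisActionConnected A' hZ') hpf')
    (ConnectedPart (BTemp P')) (treeCatVocab (ConnectedPart (BTemp P')) IsRational' IsStrictlyRational')}

/-- **[EtTh] Cor. 3.8 (iii), first clause, at the weak realified data of the connected coverings over the GENUINE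
bases `B^temp(Π)⁰`, `B^temp(Π′)⁰`** (any topological groups `Π`, `Π′`): `hcnt_i` and `IsFrobenioid_i` CLOSED by
name (`TemperedFrobenioid.isFrobenioid_connectedPart_bTemp` with p439044's `hBinj` — the term of abc-iut-w5-d179's
`isFrobenioid_ofRlfZWeak_ofGaloisActionConnected_connectedPart_bTemp`, unconditional at the genuine base).  Remaining named inputs: the Cor. 3.8 datum `h`, the `Φ`-ties (print's `Φ := ι(Φ₀^pf)`) and
`Prop34Const_i` (G-L2d2-3) — nothing else. [cite: MochizukiEtTh2009, Cor 3.8 p.81] -/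
theorem cor38_iii_ofGaloisActionConnected_connectedPart_bTemp_of_eq_mrange
    [Countable G] [Countable Z.Cusp] [Countable Z.Comp] [Countable G'] [Countable Z'.Cusp] [Countable Z'.Comp]
    (h : Cor38Hyp C₁ C₂)
    (hΦ₁ : ∀ B : (ConnectedPart (BTemp P))ᵒᵖ,
      C₁.Φ.carrier B = MonoidHom.mrange (hpf (C₁.baseOp B)).weak.toRealification)
    (hΦ₂ : ∀ B : (ConnectedPart (BTemp P'))ᵒᵖ,
      C₂.Φ.carrier B = MonoidHom.mrange (hpf' (C₂.baseOp B)).weak.toRealification)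
    (hC₁ : (DivisorMonoids.ofGaloisActionConnected A hZ).Prop34Const)
    (hC₂ : (DivisorMonoids.ofGaloisActionConnected A' hZ').Prop34Const) : Cor38_iii h :=
  cor38_iii_ofGaloisActionConnected_of_isFrobenioid_of_eq_mrange h hΦ₁ hΦ₂ hC₁ hC₂
    (C₁.isFrobenioid_connectedPart_bTemp (DivisorMonoids.ofGaloisActionConnected_ofRlfZWeak_hBinj A hZ hpf))
    (C₂.isFrobenioid_connectedPart_bTemp (DivisorMonoids.ofGaloisActionConnected_ofRlfZWeak_hBinj A' hZ' hpf'))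

end ConnectedGenuineBase


/-! ## APPENDIX (v2, append-only): the `Λ = ℝ` twins over `ofRlfRWeak` (abc-iut-L2-d2's apex p443086, abc-iut-w6-d048's p439556) -/


/-! ### `hcnt` from the `Φ`-tie `Φ(A) = ι(Φ₀(Y_A)^pf)` over any weak realified data of monoid type `ℝ` -/

namespace TemperedFrobenioid

variable {D₀ : Type u₀} [Category.{v₀} D₀] {dm : DivisorMonoids.{u₀, v₀, w} D₀}
  {hpf : ∀ Y : D₀ᵒᵖ, IsPerfFactorialCof (dm.Φ₀.obj Y)}
  {D : Type u} [Category.{v} D] {VD : FrdICatStub.{u, v, w} D}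
  (C : TemperedFrobenioid (RealifiedDivisorMonoids.ofRlfRWeak dm hpf) D VD)

/-- **`hcnt` at `A` from the `Φ`-tie**: if `Φ(A)` is print's `ι(Φ₀(Y_A)^pf) ⊆ Φ₀(Y_A)^rlf` (Ex. 3.9 (iii): "`Φ_W` …
forming the perfection of the monoid `Φ₀`"), then `Prime(Φ(A)^pf)` is countable as soon as `Prime(Φ₀(Y_A)^pf)` is —
`ι` is injective on `Φ₀^pf` (`PfImageWeak.mrangeRestrict_toRealification_bijective`) and `Prime(M) ≃ Prime(M^pf)` for
the sharp monoid `M = ι(Φ₀^pf)`. [cite: MochizukiEtTh2009, Ex 3.9 p.84] -/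
theorem countable_primes_perfection_Φ_of_eq_mrange_weakR (A : Dᵒᵖ)
    (hΦ : C.Φ.carrier A = MonoidHom.mrange (hpf (C.baseOp A)).weak.toRealification)
    [Countable (Primes (Perfection ↥(dm.Φ₀.obj (C.baseOp A))))] :
    Countable (Primes (Perfection ↥(C.Φ.carrier A))) := by
  have hM := hpf (C.baseOp A)
  haveI : Countable (Primes ↥(MonoidHom.mrange hM.weak.toRealification)) :=
    countable_primes_of_mulEquiv
      (MulEquiv.ofBijective _ (PfImageWeak.mrangeRestrict_toRealification_bijective hM.weak))
  have h := (PfImageWeak.isPerfFactorialCof_mrange_toRealification hM).weak.countable_primes_perfection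
  rw [hΦ]
  exact h

end TemperedFrobenioid

/-! ### The weak `Λ = ℝ` Cor. 3.8 (iii) apex with `hcnt` traded for the `Φ₀`-level countability -/

section General

variable {D₀ : Type u₀} [Category.{v₀} D₀] {dm : DivisorMonoids.{u₀, v₀, w} D₀}
  {hpf : ∀ Y : D₀ᵒᵖ, IsPerfFactorialCof (dm.Φ₀.obj Y)}
  {D : Type u} [Category.{v} D] {VD : FrdICatStub.{u, v, w} D}
  {D₀' : Type u₀} [Category.{v₀} D₀'] {dm' : DivisorMonoids.{u₀, v₀, w} D₀'}
  {hpf' : ∀ Y : D₀'ᵒᵖ, IsPerfFactorialCof (dm'.Φ₀.obj Y)}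
  {D' : Type u} [Category.{v} D'] {VD' : FrdICatStub.{u, v, w} D'}
  {C₁ : TemperedFrobenioid (RealifiedDivisorMonoids.ofRlfRWeak dm hpf) D VD}
  {C₂ : TemperedFrobenioid (RealifiedDivisorMonoids.ofRlfRWeak dm' hpf') D' VD'} (h : Cor38Hyp C₁ C₂)

/-- **[EtTh] Cor. 3.8 (iii), first clause, over `ofRlfRWeak` (monoid type `ℝ`), with `hcnt_i` replaced by countability of
`Prime(Φ₀(Y_A)^pf)` and the `Φ`-tie `Φ_i(A) = ι(Φ₀(Y_A)^pf)`** (abc-iut-L2-d2's `Λ = ℝ` apex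
`cor38_iii_ofRlfRWeak_of_isFrobenioid_of_countable_of_prop34Const`, p443086, ∘ `countable_primes_perfection_Φ_of_eq_mrange_weakR`).
Remaining named inputs: `IsFrobenioid_i`, `Prop34Const_i`, the `Φ`-ties, the `Φ₀`-level countabilities.
[cite: MochizukiEtTh2009, Cor 3.8 p.81] -/
theorem cor38_iii_ofRlfRWeak_of_isFrobenioid_of_eq_mrange_of_prop34Const
    (hΦ₁ : ∀ A : Dᵒᵖ, C₁.Φ.carrier A = MonoidHom.mrange (hpf (C₁.baseOp A)).weak.toRealification)
    (hΦ₂ : ∀ A : D'ᵒᵖ, C₂.Φ.carrier A = MonoidHom.mrange (hpf' (C₂.baseOp A)).weak.toRealification)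
    (hcnt₁ : ∀ A : Dᵒᵖ, Countable (Primes (Perfection ↥(dm.Φ₀.obj (C₁.baseOp A)))))
    (hcnt₂ : ∀ A : D'ᵒᵖ, Countable (Primes (Perfection ↥(dm'.Φ₀.obj (C₂.baseOp A)))))
    (hC₁ : dm.Prop34Const) (hC₂ : dm'.Prop34Const)
    (hF₁ : PreFrobenioid.IsFrobenioid C₁.toElem) (hF₂ : PreFrobenioid.IsFrobenioid C₂.toElem) :
    Cor38_iii h :=
  cor38_iii_ofRlfRWeak_of_isFrobenioid_of_countable_of_prop34Const h
    (fun A => haveI := hcnt₁ A; C₁.countable_primes_perfection_Φ_of_eq_mrange_weakR A (hΦ₁ A))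
    (fun A => haveI := hcnt₂ A; C₂.countable_primes_perfection_Φ_of_eq_mrange_weakR A (hΦ₂ A))
    hC₁ hC₂ hF₁ hF₂

end General

/-! ### At the constructed data of the connected coverings: `hcnt` is a theorem -/

section Connected

open LogDivisorModel.GaloisAction

variable {Z : LogDivisorModel.{u}} {G : Type u} [Group G] {A : Z.GaloisAction G} {hZ : Z.CuspLaws}
  {hpf : ∀ Y : ((isConnectedGSet (G := G)).FullSubcategory)ᵒᵖ,
    IsPerfFactorialCof ((DivisorMonoids.ofGaloisActionConnected A hZ).Φ₀.obj Y)}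
  {Z' : LogDivisorModel.{u}} {G' : Type u} [Group G'] {A' : Z'.GaloisAction G'} {hZ' : Z'.CuspLaws}
  {hpf' : ∀ Y : ((isConnectedGSet (G := G')).FullSubcategory)ᵒᵖ,
    IsPerfFactorialCof ((DivisorMonoids.ofGaloisActionConnected A' hZ').Φ₀.obj Y)}
  {D : Type u'} [Category.{v'} D] {VD : FrdICatStub.{u', v', u} D}
  {D' : Type u'} [Category.{v'} D'] {VD' : FrdICatStub.{u', v', u} D'}
  {C₁ : TemperedFrobenioid
    (RealifiedDivisorMonoids.ofRlfRWeak (DivisorMonoids.ofGaloisActionConnected A hZ) hpf) D VD}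
  {C₂ : TemperedFrobenioid
    (RealifiedDivisorMonoids.ofRlfRWeak (DivisorMonoids.ofGaloisActionConnected A' hZ') hpf') D' VD'}

/-- **[EtTh] Cor. 3.8 (iii), first clause, at the weak `Λ = ℝ` realified data of the CONNECTED coverings, `hcnt_i` CLOSED by
name** (`DivisorMonoids.countable_primes_perfection_Φ₀_ofGaloisActionConnected`, p441898 ∘ p440853): for tempered
Frobenioids `C_i` over `ofRlfZWeak (ofGaloisActionConnected A_i hZ_i) hpf_i` with print's divisor monoids
`Φ_i(A) = ι(Φ₀(Y_A)^pf)` and countable `Gal(Z^log_∞/X^log)`, cusps and special-fibre components, the remaining named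
inputs are `IsFrobenioid_i` and `Prop34Const_i` (G-L2d2-3). [cite: MochizukiEtTh2009, Cor 3.8 p.81] -/
theorem cor38_iii_ofGaloisActionConnectedR_of_isFrobenioid_of_eq_mrange
    [Countable G] [Countable Z.Cusp] [Countable Z.Comp] [Countable G'] [Countable Z'.Cusp] [Countable Z'.Comp]
    (h : Cor38Hyp C₁ C₂)
    (hΦ₁ : ∀ B : Dᵒᵖ, C₁.Φ.carrier B = MonoidHom.mrange (hpf (C₁.baseOp B)).weak.toRealification)
    (hΦ₂ : ∀ B : D'ᵒᵖ, C₂.Φ.carrier B = MonoidHom.mrange (hpf' (C₂.baseOp B)).weak.toRealification)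
    (hC₁ : (DivisorMonoids.ofGaloisActionConnected A hZ).Prop34Const)
    (hC₂ : (DivisorMonoids.ofGaloisActionConnected A' hZ').Prop34Const)
    (hF₁ : PreFrobenioid.IsFrobenioid C₁.toElem) (hF₂ : PreFrobenioid.IsFrobenioid C₂.toElem) :
    Cor38_iii h :=
  cor38_iii_ofRlfRWeak_of_isFrobenioid_of_eq_mrange_of_prop34Const h hΦ₁ hΦ₂
    (fun B => DivisorMonoids.countable_primes_perfection_Φ₀_ofGaloisActionConnected A hZ (C₁.baseOp B))
    (fun B => DivisorMonoids.countable_primes_perfection_Φ₀_ofGaloisActionConnected A' hZ' (C₂.baseOp B))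
    hC₁ hC₂ hF₁ hF₂

end Connected

/-! ### … and `IsFrobenioid` discharged over the genuine category vocabulary -/

section ConnectedFSM

open LogDivisorModel.GaloisAction

variable {Z : LogDivisorModel.{u}} {G : Type u} [Group G] {A : Z.GaloisAction G} {hZ : Z.CuspLaws}
  {hpf : ∀ Y : ((isConnectedGSet (G := G)).FullSubcategory)ᵒᵖ,
    IsPerfFactorialCof ((DivisorMonoids.ofGaloisActionConnected A hZ).Φ₀.obj Y)}
  {Z' : LogDivisorModel.{u}} {G' : Type u} [Group G'] {A' : Z'.GaloisAction G'} {hZ' : Z'.CuspLaws}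
  {hpf' : ∀ Y : ((isConnectedGSet (G := G')).FullSubcategory)ᵒᵖ,
    IsPerfFactorialCof ((DivisorMonoids.ofGaloisActionConnected A' hZ').Φ₀.obj Y)}
  {D : Type u'} [Category.{v'} D] {IsRational IsStrictlyRational : (Dᵒᵖ ⥤ CommMonCat.{u}) → Prop}
  {D' : Type u'} [Category.{v'} D'] {IsRational' IsStrictlyRational' : (D'ᵒᵖ ⥤ CommMonCat.{u}) → Prop}
  {C₁ : TemperedFrobenioid
    (RealifiedDivisorMonoids.ofRlfRWeak (DivisorMonoids.ofGaloisActionConnected A hZ) hpf) D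
    (treeCatVocab D IsRational IsStrictlyRational)}
  {C₂ : TemperedFrobenioid
    (RealifiedDivisorMonoids.ofRlfRWeak (DivisorMonoids.ofGaloisActionConnected A' hZ') hpf') D'
    (treeCatVocab D' IsRational' IsStrictlyRational')}

/-- **[EtTh] Cor. 3.8 (iii), first clause, at the weak `Λ = ℝ` realified data of the connected coverings over ANY bases of
FSM-type in the genuine category vocabulary, monoid type `ℝ` — `hcnt_i` AND `IsFrobenioid_i` CLOSED by name**
(«`C` is a Frobenioid», [FrdI] Thm. 5.2 (ii): abc-iut-w6-d048's
`TemperedFrobenioid.isFrobenioid_ofRlfRWeak_ofGaloisActionConnected_of_isOfFSMType`, p439556).  Remaining named inputs: the Cor. 3.8 datum `h`, the `Φ`-ties (print's `Φ := ι(Φ₀^pf)`),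
`Prop34Const_i` (G-L2d2-3), `IsOfFSMType D_i` ([FrdII] Ex. 1.3 (i) at `B^temp(Π)⁰`). [cite: MochizukiEtTh2009, Cor 3.8 p.81] -/
theorem cor38_iii_ofGaloisActionConnectedR_of_isOfFSMType_of_eq_mrange
    [Countable G] [Countable Z.Cusp] [Countable Z.Comp] [Countable G'] [Countable Z'.Cusp] [Countable Z'.Comp]
    (h : Cor38Hyp C₁ C₂) (hD : IsOfFSMType D) (hD' : IsOfFSMType D')
    (hΦ₁ : ∀ B : Dᵒᵖ, C₁.Φ.carrier B = MonoidHom.mrange (hpf (C₁.baseOp B)).weak.toRealification)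
    (hΦ₂ : ∀ B : D'ᵒᵖ, C₂.Φ.carrier B = MonoidHom.mrange (hpf' (C₂.baseOp B)).weak.toRealification)
    (hC₁ : (DivisorMonoids.ofGaloisActionConnected A hZ).Prop34Const)
    (hC₂ : (DivisorMonoids.ofGaloisActionConnected A' hZ').Prop34Const) : Cor38_iii h :=
  cor38_iii_ofGaloisActionConnectedR_of_isFrobenioid_of_eq_mrange h hΦ₁ hΦ₂ hC₁ hC₂
    (TemperedFrobenioid.isFrobenioid_ofRlfRWeak_ofGaloisActionConnected_of_isOfFSMType A hZ hpf C₁ hD)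
    (TemperedFrobenioid.isFrobenioid_ofRlfRWeak_ofGaloisActionConnected_of_isOfFSMType A' hZ' hpf' C₂ hD')

end ConnectedFSM

section ConnectedGenuineBase

open LogDivisorModel.GaloisAction

variable {Z : LogDivisorModel.{u}} {G : Type u} [Group G] {A : Z.GaloisAction G} {hZ : Z.CuspLaws}
  {hpf : ∀ Y : ((isConnectedGSet (G := G)).FullSubcategory)ᵒᵖ,
    IsPerfFactorialCof ((DivisorMonoids.ofGaloisActionConnected A hZ).Φ₀.obj Y)}
  {Z' : LogDivisorModel.{u}} {G' : Type u} [Group G'] {A' : Z'.GaloisAction G'} {hZ' : Z'.CuspLaws}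
  {hpf' : ∀ Y : ((isConnectedGSet (G := G')).FullSubcategory)ᵒᵖ,
    IsPerfFactorialCof ((DivisorMonoids.ofGaloisActionConnected A' hZ').Φ₀.obj Y)}
  {P : Type v'} [Group P] [TopologicalSpace P]
  {IsRational IsStrictlyRational : ((ConnectedPart (BTemp P))ᵒᵖ ⥤ CommMonCat.{u}) → Prop}
  {P' : Type v'} [Group P'] [TopologicalSpace P']
  {IsRational' IsStrictlyRational' : ((ConnectedPart (BTemp P'))ᵒᵖ ⥤ CommMonCat.{u}) → Prop}
  {C₁ : TemperedFrobenioid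
    (RealifiedDivisorMonoids.ofRlfRWeak (DivisorMonoids.ofGaloisActionConnected A hZ) hpf)
    (ConnectedPart (BTemp P)) (treeCatVocab (ConnectedPart (BTemp P)) IsRational IsStrictlyRational)}
  {C₂ : TemperedFrobenioid
    (RealifiedDivisorMonoids.ofRlfRWeak (DivisorMonoids.ofGaloisActionConnected A' hZ') hpf')
    (ConnectedPart (BTemp P')) (treeCatVocab (ConnectedPart (BTemp P')) IsRational' IsStrictlyRational')}

/-- **[EtTh] Cor. 3.8 (iii), first clause, at the weak `Λ = ℝ` realified data of the connected coverings over the GENUINE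
bases `B^temp(Π)⁰`, `B^temp(Π′)⁰`** (any topological groups `Π`, `Π′`): `hcnt_i` and `IsFrobenioid_i` CLOSED by
name (abc-iut-w6-d048's `TemperedFrobenioid.isFrobenioid_ofRlfRWeak_ofGaloisActionConnected_connectedPart_bTemp`,
p439556, unconditional at the genuine base; monoid type `ℝ`).  Remaining named inputs: the Cor. 3.8 datum `h`, the `Φ`-ties (print's `Φ := ι(Φ₀^pf)`) and
`Prop34Const_i` (G-L2d2-3) — nothing else. [cite: MochizukiEtTh2009, Cor 3.8 p.81] -/
theorem cor38_iii_ofGaloisActionConnectedR_connectedPart_bTemp_of_eq_mrange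
    [Countable G] [Countable Z.Cusp] [Countable Z.Comp] [Countable G'] [Countable Z'.Cusp] [Countable Z'.Comp]
    (h : Cor38Hyp C₁ C₂)
    (hΦ₁ : ∀ B : (ConnectedPart (BTemp P))ᵒᵖ,
      C₁.Φ.carrier B = MonoidHom.mrange (hpf (C₁.baseOp B)).weak.toRealification)
    (hΦ₂ : ∀ B : (ConnectedPart (BTemp P'))ᵒᵖ,
      C₂.Φ.carrier B = MonoidHom.mrange (hpf' (C₂.baseOp B)).weak.toRealification)
    (hC₁ : (DivisorMonoids.ofGaloisActionConnected A hZ).Prop34Const)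
    (hC₂ : (DivisorMonoids.ofGaloisActionConnected A' hZ').Prop34Const) : Cor38_iii h :=
  cor38_iii_ofGaloisActionConnectedR_of_isFrobenioid_of_eq_mrange h hΦ₁ hΦ₂ hC₁ hC₂
    (TemperedFrobenioid.isFrobenioid_ofRlfRWeak_ofGaloisActionConnected_connectedPart_bTemp A hZ hpf C₁)
    (TemperedFrobenioid.isFrobenioid_ofRlfRWeak_ofGaloisActionConnected_connectedPart_bTemp A' hZ' hpf' C₂)

end ConnectedGenuineBase


/-! ## APPENDIX (v3, append-only): the `Λ = ℚ` twins over `ofRlfQWeak` (abc-iut-L2-d2's apex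
`cor38_iii_ofRlfQWeak_of_isFrobenioid_of_countable_of_prop34Const`, abc-iut-w5-d179's `ofGaloisActionConnected_ofRlfQWeak_hBinj`
p439044) — completing the three monoid types `Λ ∈ {ℤ, ℚ, ℝ}` of [EtTh] Def. 3.6 (i) -/

namespace TemperedFrobenioid

variable {D₀ : Type u₀} [Category.{v₀} D₀] {dm : DivisorMonoids.{u₀, v₀, w} D₀}
  {hpf : ∀ Y : D₀ᵒᵖ, IsPerfFactorialCof (dm.Φ₀.obj Y)}
  {D : Type u} [Category.{v} D] {VD : FrdICatStub.{u, v, w} D}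
  (C : TemperedFrobenioid (RealifiedDivisorMonoids.ofRlfQWeak dm hpf) D VD)

/-- **`hcnt` at `A` from the `Φ`-tie, monoid type `ℚ`** (same proof as at `Λ = ℤ`: `ofRlfQWeak` has the same `Φ^{ℝ-log}`).
[cite: MochizukiEtTh2009, Ex 3.9 p.84] -/
theorem countable_primes_perfection_Φ_of_eq_mrange_weakQ (A : Dᵒᵖ)
    (hΦ : C.Φ.carrier A = MonoidHom.mrange (hpf (C.baseOp A)).weak.toRealification)
    [Countable (Primes (Perfection ↥(dm.Φ₀.obj (C.baseOp A))))] :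
    Countable (Primes (Perfection ↥(C.Φ.carrier A))) := by
  have hM := hpf (C.baseOp A)
  haveI : Countable (Primes ↥(MonoidHom.mrange hM.weak.toRealification)) :=
    countable_primes_of_mulEquiv
      (MulEquiv.ofBijective _ (PfImageWeak.mrangeRestrict_toRealification_bijective hM.weak))
  have h := (PfImageWeak.isPerfFactorialCof_mrange_toRealification hM).weak.countable_primes_perfection
  rw [hΦ]
  exact h

end TemperedFrobenioid

section GeneralQ

variable {D₀ : Type u₀} [Category.{v₀} D₀] {dm : DivisorMonoids.{u₀, v₀, w} D₀}
  {hpf : ∀ Y : D₀ᵒᵖ, IsPerfFactorialCof (dm.Φ₀.obj Y)}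
  {D : Type u} [Category.{v} D] {VD : FrdICatStub.{u, v, w} D}
  {D₀' : Type u₀} [Category.{v₀} D₀'] {dm' : DivisorMonoids.{u₀, v₀, w} D₀'}
  {hpf' : ∀ Y : D₀'ᵒᵖ, IsPerfFactorialCof (dm'.Φ₀.obj Y)}
  {D' : Type u} [Category.{v} D'] {VD' : FrdICatStub.{u, v, w} D'}
  {C₁ : TemperedFrobenioid (RealifiedDivisorMonoids.ofRlfQWeak dm hpf) D VD}
  {C₂ : TemperedFrobenioid (RealifiedDivisorMonoids.ofRlfQWeak dm' hpf') D' VD'} (h : Cor38Hyp C₁ C₂)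

/-- **[EtTh] Cor. 3.8 (iii), first clause, over `ofRlfQWeak` (monoid type `ℚ`), with `hcnt_i` replaced by countability of
`Prime(Φ₀(Y_A)^pf)` and the `Φ`-tie** (abc-iut-L2-d2's `Λ = ℚ` apex ∘ `countable_primes_perfection_Φ_of_eq_mrange_weakQ`).
[cite: MochizukiEtTh2009, Cor 3.8 p.81] -/
theorem cor38_iii_ofRlfQWeak_of_isFrobenioid_of_eq_mrange_of_prop34Const
    (hΦ₁ : ∀ A : Dᵒᵖ, C₁.Φ.carrier A = MonoidHom.mrange (hpf (C₁.baseOp A)).weak.toRealification)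
    (hΦ₂ : ∀ A : D'ᵒᵖ, C₂.Φ.carrier A = MonoidHom.mrange (hpf' (C₂.baseOp A)).weak.toRealification)
    (hcnt₁ : ∀ A : Dᵒᵖ, Countable (Primes (Perfection ↥(dm.Φ₀.obj (C₁.baseOp A)))))
    (hcnt₂ : ∀ A : D'ᵒᵖ, Countable (Primes (Perfection ↥(dm'.Φ₀.obj (C₂.baseOp A)))))
    (hC₁ : dm.Prop34Const) (hC₂ : dm'.Prop34Const)
    (hF₁ : PreFrobenioid.IsFrobenioid C₁.toElem) (hF₂ : PreFrobenioid.IsFrobenioid C₂.toElem) :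
    Cor38_iii h :=
  cor38_iii_ofRlfQWeak_of_isFrobenioid_of_countable_of_prop34Const h
    (fun A => haveI := hcnt₁ A; C₁.countable_primes_perfection_Φ_of_eq_mrange_weakQ A (hΦ₁ A))
    (fun A => haveI := hcnt₂ A; C₂.countable_primes_perfection_Φ_of_eq_mrange_weakQ A (hΦ₂ A))
    hC₁ hC₂ hF₁ hF₂

end GeneralQ

section ConnectedQ

open LogDivisorModel.GaloisAction

variable {Z : LogDivisorModel.{u}} {G : Type u} [Group G] {A : Z.GaloisAction G} {hZ : Z.CuspLaws}
  {hpf : ∀ Y : ((isConnectedGSet (G := G)).FullSubcategory)ᵒᵖ,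
    IsPerfFactorialCof ((DivisorMonoids.ofGaloisActionConnected A hZ).Φ₀.obj Y)}
  {Z' : LogDivisorModel.{u}} {G' : Type u} [Group G'] {A' : Z'.GaloisAction G'} {hZ' : Z'.CuspLaws}
  {hpf' : ∀ Y : ((isConnectedGSet (G := G')).FullSubcategory)ᵒᵖ,
    IsPerfFactorialCof ((DivisorMonoids.ofGaloisActionConnected A' hZ').Φ₀.obj Y)}

/-- **[EtTh] Cor. 3.8 (iii), first clause, `Λ = ℚ`, at the weak realified data of the CONNECTED coverings, `hcnt_i` CLOSED by
name** (countable `G_i`, cusps, components); remaining inputs `IsFrobenioid_i`, `Prop34Const_i`, the Φ-ties.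
[cite: MochizukiEtTh2009, Cor 3.8 p.81] -/
theorem cor38_iii_ofGaloisActionConnectedQ_of_isFrobenioid_of_eq_mrange
    {D : Type u'} [Category.{v'} D] {VD : FrdICatStub.{u', v', u} D}
    {D' : Type u'} [Category.{v'} D'] {VD' : FrdICatStub.{u', v', u} D'}
    {C₁ : TemperedFrobenioid
      (RealifiedDivisorMonoids.ofRlfQWeak (DivisorMonoids.ofGaloisActionConnected A hZ) hpf) D VD}
    {C₂ : TemperedFrobenioid
      (RealifiedDivisorMonoids.ofRlfQWeak (DivisorMonoids.ofGaloisActionConnected A' hZ') hpf') D' VD'}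
    [Countable G] [Countable Z.Cusp] [Countable Z.Comp] [Countable G'] [Countable Z'.Cusp] [Countable Z'.Comp]
    (h : Cor38Hyp C₁ C₂)
    (hΦ₁ : ∀ B : Dᵒᵖ, C₁.Φ.carrier B = MonoidHom.mrange (hpf (C₁.baseOp B)).weak.toRealification)
    (hΦ₂ : ∀ B : D'ᵒᵖ, C₂.Φ.carrier B = MonoidHom.mrange (hpf' (C₂.baseOp B)).weak.toRealification)
    (hC₁ : (DivisorMonoids.ofGaloisActionConnected A hZ).Prop34Const)
    (hC₂ : (DivisorMonoids.ofGaloisActionConnected A' hZ').Prop34Const)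
    (hF₁ : PreFrobenioid.IsFrobenioid C₁.toElem) (hF₂ : PreFrobenioid.IsFrobenioid C₂.toElem) :
    Cor38_iii h :=
  cor38_iii_ofRlfQWeak_of_isFrobenioid_of_eq_mrange_of_prop34Const h hΦ₁ hΦ₂
    (fun B => DivisorMonoids.countable_primes_perfection_Φ₀_ofGaloisActionConnected A hZ (C₁.baseOp B))
    (fun B => DivisorMonoids.countable_primes_perfection_Φ₀_ofGaloisActionConnected A' hZ' (C₂.baseOp B))
    hC₁ hC₂ hF₁ hF₂

/-- **`Λ = ℚ`, bases of FSM-type in the genuine category vocabulary: `hcnt_i` AND `IsFrobenioid_i` CLOSED by name**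
(`TemperedFrobenioid.isFrobenioid_of_isOfFSMType` with abc-iut-w5-d179's `ofGaloisActionConnected_ofRlfQWeak_hBinj`, p439044).
[cite: MochizukiEtTh2009, Cor 3.8 p.81] -/
theorem cor38_iii_ofGaloisActionConnectedQ_of_isOfFSMType_of_eq_mrange
    {D : Type u'} [Category.{v'} D] {IsRational IsStrictlyRational : (Dᵒᵖ ⥤ CommMonCat.{u}) → Prop}
    {D' : Type u'} [Category.{v'} D'] {IsRational' IsStrictlyRational' : (D'ᵒᵖ ⥤ CommMonCat.{u}) → Prop}
    {C₁ : TemperedFrobenioid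
      (RealifiedDivisorMonoids.ofRlfQWeak (DivisorMonoids.ofGaloisActionConnected A hZ) hpf) D
      (treeCatVocab D IsRational IsStrictlyRational)}
    {C₂ : TemperedFrobenioid
      (RealifiedDivisorMonoids.ofRlfQWeak (DivisorMonoids.ofGaloisActionConnected A' hZ') hpf') D'
      (treeCatVocab D' IsRational' IsStrictlyRational')}
    [Countable G] [Countable Z.Cusp] [Countable Z.Comp] [Countable G'] [Countable Z'.Cusp] [Countable Z'.Comp]
    (h : Cor38Hyp C₁ C₂) (hD : IsOfFSMType D) (hD' : IsOfFSMType D')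
    (hΦ₁ : ∀ B : Dᵒᵖ, C₁.Φ.carrier B = MonoidHom.mrange (hpf (C₁.baseOp B)).weak.toRealification)
    (hΦ₂ : ∀ B : D'ᵒᵖ, C₂.Φ.carrier B = MonoidHom.mrange (hpf' (C₂.baseOp B)).weak.toRealification)
    (hC₁ : (DivisorMonoids.ofGaloisActionConnected A hZ).Prop34Const)
    (hC₂ : (DivisorMonoids.ofGaloisActionConnected A' hZ').Prop34Const) : Cor38_iii h :=
  cor38_iii_ofGaloisActionConnectedQ_of_isFrobenioid_of_eq_mrange h hΦ₁ hΦ₂ hC₁ hC₂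
    (C₁.isFrobenioid_of_isOfFSMType (DivisorMonoids.ofGaloisActionConnected_ofRlfQWeak_hBinj A hZ hpf) hD)
    (C₂.isFrobenioid_of_isOfFSMType (DivisorMonoids.ofGaloisActionConnected_ofRlfQWeak_hBinj A' hZ' hpf') hD')

/-- **`Λ = ℚ` at the genuine bases `B^temp(Π)⁰`: `hcnt_i` and `IsFrobenioid_i` CLOSED** — remaining inputs: the Cor. 3.8 datum, the
Φ-ties, `Prop34Const_i`. [cite: MochizukiEtTh2009, Cor 3.8 p.81] -/
theorem cor38_iii_ofGaloisActionConnectedQ_connectedPart_bTemp_of_eq_mrange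
    {P : Type v'} [Group P] [TopologicalSpace P]
    {IsRational IsStrictlyRational : ((ConnectedPart (BTemp P))ᵒᵖ ⥤ CommMonCat.{u}) → Prop}
    {P' : Type v'} [Group P'] [TopologicalSpace P']
    {IsRational' IsStrictlyRational' : ((ConnectedPart (BTemp P'))ᵒᵖ ⥤ CommMonCat.{u}) → Prop}
    {C₁ : TemperedFrobenioid
      (RealifiedDivisorMonoids.ofRlfQWeak (DivisorMonoids.ofGaloisActionConnected A hZ) hpf)
      (ConnectedPart (BTemp P)) (treeCatVocab (ConnectedPart (BTemp P)) IsRational IsStrictlyRational)}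
    {C₂ : TemperedFrobenioid
      (RealifiedDivisorMonoids.ofRlfQWeak (DivisorMonoids.ofGaloisActionConnected A' hZ') hpf')
      (ConnectedPart (BTemp P')) (treeCatVocab (ConnectedPart (BTemp P')) IsRational' IsStrictlyRational')}
    [Countable G] [Countable Z.Cusp] [Countable Z.Comp] [Countable G'] [Countable Z'.Cusp] [Countable Z'.Comp]
    (h : Cor38Hyp C₁ C₂)
    (hΦ₁ : ∀ B : (ConnectedPart (BTemp P))ᵒᵖ,
      C₁.Φ.carrier B = MonoidHom.mrange (hpf (C₁.baseOp B)).weak.toRealification)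
    (hΦ₂ : ∀ B : (ConnectedPart (BTemp P'))ᵒᵖ,
      C₂.Φ.carrier B = MonoidHom.mrange (hpf' (C₂.baseOp B)).weak.toRealification)
    (hC₁ : (DivisorMonoids.ofGaloisActionConnected A hZ).Prop34Const)
    (hC₂ : (DivisorMonoids.ofGaloisActionConnected A' hZ').Prop34Const) : Cor38_iii h :=
  cor38_iii_ofGaloisActionConnectedQ_of_isFrobenioid_of_eq_mrange h hΦ₁ hΦ₂ hC₁ hC₂
    (C₁.isFrobenioid_connectedPart_bTemp (DivisorMonoids.ofGaloisActionConnected_ofRlfQWeak_hBinj A hZ hpf))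
    (C₂.isFrobenioid_connectedPart_bTemp (DivisorMonoids.ofGaloisActionConnected_ofRlfQWeak_hBinj A' hZ' hpf'))

end ConnectedQ

end Literature.AnabelianGeometry.EtaleTheta
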